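import Summits.NavierStokesRegularity.NavierStokesRegularity.Theorems.ExtremiserTransienceTwoThirdsPieceBounds
import Summits.NavierStokesRegularity.NavierStokesRegularity.Theorems.ExtremiserTransienceTwoThirdsPieceL2
import Summits.NavierStokesRegularity.NavierStokesRegularity.Theorems.ExtremiserTransienceTwoThirdsCellConstants
import HarnessLib

/-!
# Route `ExtremiserTransience`, crux `NearExtremalTransiencePerFlow` (stmt-NavierStokesRegularity-26567),
# LINE g10-1 «two_thirds» (ns-idea-10), stub S1a′ — BRICK 2, lemma P4a: THE PIECE OF A CELL AT SCALE `ρ` (construction + all sizes)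

`--supports stmt-NavierStokesRegularity-26567` (helper; prover seat ns-net-p2 g13).  Normalised units (`‖w‖ ≤ 1`, `‖Dw‖ ≤ A₁`, linear growth `A_E`).
For every centre `c` and scale `ρ ≥ 2` the cell `B(c, ρ⁸)` (layer `L = B(c,ρ⁸+ρ⁷) ∖ B(c,ρ⁸)`) carries an ADMISSIBLE PIECE `φ = curl(χ·K∗(ζw))`
(`χ` = `cutoff_package`, `ζ = ballCutoff c ρ⁸`) and `cell_piece` (next file) lists, with ONE constant `Cc = Cc(A₁, A_E)`, everything the excess estimate and
the remainder piece need: `φ` is `C^∞_c`, divergence free, supported in `B(c, 3ρ⁸/2)`; `χ ∈ [0,1]`, `= 1` on the cell, `= 0` off `B(c,ρ⁸+ρ⁷)`;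
`‖φ − χw‖ ≤ Cc/ρ²` and `‖Dφ − χDw‖ ≤ Cc/ρ²` everywhere (both vanishing off `tsupport χ`); the enstrophy / palinstrophy offsets vanish off `L`
and have `∫‖curl φ − χω‖² ≤ Cc/ρ²`, `∫‖D(curl φ) − χDω‖² ≤ Cc·(Z_{B(c,2ρ⁸)} + Z_{B(c,4ρ⁸)} + ∫_{B(c,2ρ⁸)}‖Dw‖² + 1)/ρ²`.
Assembly of p729975 (pointwise identities), p730553 (gauge sizes), p731375 (sizes → bounds), p732466 (`L²` from pointwise), p732921 (ρ-arithmetic):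
`cell_piece_pointwise` (abstract gauge, concrete sizes), `cell_e1_L2`, `cell_e2_L2` (the two `L²` budgets); the package `cell_piece` follows in `…TwoThirdsCellPackage`.
HONEST FRAMING: nothing about Navier–Stokes is proved; no summit is proved by a line. [folklore]
-/

noncomputable section

open scoped Topology InnerProductSpace RealInnerProductSpace ENNReal NNReal ContDiff
open MeasureTheory Filter Set Metric
open Literature.Analysis.FluidPDE
open Summit.NavierStokesRegularity.NavierStokesRegularity.Theorems.DepletionLadder.KStar.HalfSpace
open Summit.NavierStokesRegularity.NavierStokesRegularity.Theorems.NearExtremalTransiencePerFlow.LocalMaximiser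

namespace Summit.NavierStokesRegularity.NavierStokesRegularity.Theorems.NearExtremalTransiencePerFlow.TwoThirds

-- the summit's namespace repeats the problem name by convention (D-0017)
set_option linter.dupNamespace false

section Cell

variable {w ψ G : E3 → E3} {χ : E3 → ℝ} {c : E3} {ρ a b K₁ K₂ : ℝ}

/-- **Pointwise package of a cell piece** (abstract gauge `ψ`, `curl ψ = w − G`, with the concrete sizes at scale `ρ`):
`‖φ − χw‖ ≤ (a + cK₁a)/ρ²`, `‖Dφ − χDw‖ ≤ (K₁ + a + K₁a + 2cK₂a + cK₁b)/ρ²`, both vanishing off `tsupport χ`. [folklore] -/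
theorem cell_piece_pointwise (hρ : 2 ≤ ρ) (ha : 0 ≤ a) (hb : 0 ≤ b) (hK₁ : 0 ≤ K₁) (hK₂ : 0 ≤ K₂)
    (hw : ContDiff ℝ (⊤ : ℕ∞) w) (hw1 : ∀ x, ‖w x‖ ≤ 1) (hψ : ContDiff ℝ (⊤ : ℕ∞) ψ) (hG : ContDiff ℝ (⊤ : ℕ∞) G)
    (hχ : ContDiff ℝ (⊤ : ℕ∞) χ) (hcurl : ∀ x, curl ψ x = w x - G x) (hχ1 : ∀ x, |χ x| ≤ 1)
    (hχsupp : tsupport χ ⊆ ball c (3 / 2 * ρ ^ 8))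
    (hD1 : ∀ x, ‖fderiv ℝ χ x‖ ≤ K₁ / ρ ^ 7) (hD2 : ∀ x, ‖iteratedFDeriv ℝ 2 χ x‖ ≤ 2 * K₂ / (ρ ^ 7) ^ 2)
    (hGle : ∀ x ∈ ball c (3 / 2 * ρ ^ 8), ‖G x‖ ≤ a / ρ ^ 8) (hDGle : ∀ x ∈ ball c (3 / 2 * ρ ^ 8), ‖fderiv ℝ G x‖ ≤ a / ρ ^ 16)
    (hψle : ∀ x ∈ ball c (3 / 2 * ρ ^ 8), ‖ψ x‖ ≤ a * ρ) (hDψle : ∀ x, ‖fderiv ℝ ψ x‖ ≤ b * ρ ^ 4) :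
    (∀ x, ‖curl (fun y => χ y • ψ y) x - χ x • w x‖ ≤ (a + ‖curlCLM‖ * K₁ * a) / ρ ^ 2) ∧
    (∀ x, x ∉ tsupport χ → curl (fun y => χ y • ψ y) x - χ x • w x = 0) ∧
    (∀ x, ‖fderiv ℝ (curl fun y => χ y • ψ y) x - χ x • fderiv ℝ w x‖ ≤
      (K₁ + a + K₁ * a + 2 * ‖curlCLM‖ * K₂ * a + ‖curlCLM‖ * K₁ * b) / ρ ^ 2) ∧
    (∀ x, x ∉ tsupport χ → fderiv ℝ (curl fun y => χ y • ψ y) x - χ x • fderiv ℝ w x = 0) := by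
  have hρ0 : 0 < ρ := by linarith
  have hcc0 : 0 ≤ ‖curlCLM‖ := norm_nonneg curlCLM
  have hk10 : 0 ≤ K₁ / ρ ^ 7 := by positivity
  have hk20 : 0 ≤ 2 * K₂ / (ρ ^ 7) ^ 2 := by positivity
  have hg00 : 0 ≤ a / ρ ^ 8 := by positivity
  have hg10 : 0 ≤ a / ρ ^ 16 := by positivity
  have hp00 : 0 ≤ a * ρ := by positivity
  have hp10 : 0 ≤ b * ρ ^ 4 := by positivity
  refine ⟨fun x => ?_, fun x hx => ?_, fun x => ?_, fun x hx => ?_⟩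
  · have hφeq := congrFun (piece_eq hχ hψ hcurl) x
    have hdiff : curl (fun y => χ y • ψ y) x - χ x • w x = -(χ x • G x) + curlCLM ((fderiv ℝ χ x).smulRight (ψ x)) := by
      rw [hφeq]; abel
    rw [hdiff]
    by_cases hxS : x ∈ tsupport χ
    · have hx : x ∈ ball c (3 / 2 * ρ ^ 8) := hχsupp hxS
      have t1 : ‖-(χ x • G x)‖ ≤ a / ρ ^ 8 := by
        rw [norm_neg, norm_smul, Real.norm_eq_abs]
        calc |χ x| * ‖G x‖ ≤ 1 * (a / ρ ^ 8) := mul_le_mul (hχ1 x) (hGle x hx) (norm_nonneg _) zero_le_one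
          _ = a / ρ ^ 8 := one_mul _
      have t2 : ‖curlCLM ((fderiv ℝ χ x).smulRight (ψ x))‖ ≤ ‖curlCLM‖ * (K₁ / ρ ^ 7) * (a * ρ) :=
        (norm_rankOneCurl_le χ ψ x).trans (mul_le_mul (mul_le_mul_of_nonneg_left (hD1 x) hcc0) (hψle x hx) (norm_nonneg _)
          (mul_nonneg hcc0 hk10))
      have t3 := cell_height_const (a := a) (cc := ‖curlCLM‖) (K₁ := K₁) hρ ha hcc0 hK₁
      calc ‖-(χ x • G x) + curlCLM ((fderiv ℝ χ x).smulRight (ψ x))‖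
          ≤ ‖-(χ x • G x)‖ + ‖curlCLM ((fderiv ℝ χ x).smulRight (ψ x))‖ := norm_add_le _ _
        _ ≤ _ := by linarith only [t1, t2, t3]
    · have hχx : χ x = 0 := image_eq_zero_of_notMem_tsupport hxS
      have hDχ : fderiv ℝ χ x = 0 := fderiv_of_notMem_tsupport ℝ hxS
      rw [hχx, hDχ, zero_smul, neg_zero, ContinuousLinearMap.zero_smulRight, map_zero, add_zero, norm_zero]
      positivity
  · have hφeq := congrFun (piece_eq hχ hψ hcurl) x
    have hχx : χ x = 0 := image_eq_zero_of_notMem_tsupport hx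
    have hDχ : fderiv ℝ χ x = 0 := fderiv_of_notMem_tsupport ℝ hx
    rw [hφeq, hχx, hDχ, zero_smul, zero_smul, ContinuousLinearMap.zero_smulRight, map_zero, sub_zero, add_zero, sub_zero]
  · have h := norm_fderiv_piece_sub_le_of_sizes hw hψ hG hχ hcurl hχsupp hw1 hχ1 hk10 hk20 hg00 hg10 hp00 hp10
      hD1 hD2 hGle hDGle hψle hDψle x
    have t3 := cell_grad_const (a := a) (b := b) (cc := ‖curlCLM‖) (K₁ := K₁) (K₂ := K₂) hρ ha hb hcc0 hK₁ hK₂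
    exact h.trans t3
  · have hχ0 : χ =ᶠ[𝓝 x] 0 := notMem_tsupport_iff_eventuallyEq.1 hx
    have hχ0' : ∀ᶠ y in 𝓝 x, χ =ᶠ[𝓝 y] 0 := hχ0.eventually_nhds
    have hev : (curl fun y => χ y • ψ y) =ᶠ[𝓝 x] fun _ => (0 : E3) := by
      filter_upwards [hχ0'] with y hy
      refine curl_eq_zero_of_notMem_tsupport fun h => ?_
      exact (notMem_tsupport_iff_eventuallyEq.2 hy) ((tsupport_smul_subset_left _ _) h)
    have hχx : χ x = 0 := image_eq_zero_of_notMem_tsupport hx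
    have h1 : fderiv ℝ (curl fun y => χ y • ψ y) x = 0 := by rw [hev.fderiv_eq, fderiv_const_apply]
    have h2 : χ x • fderiv ℝ w x = 0 := by rw [hχx]; exact zero_smul ℝ (fderiv ℝ w x)
    rw [h1, h2, sub_zero]

variable {A_E C : ℝ}

/-- **`L²` budget of the enstrophy offset of a cell piece**: for any field `e` vanishing off the layer and bounded there by
`α₁ + c k₁‖w‖ + c²k₁‖Dψ‖` (the shape of `norm_curl_piece_sub_le_of_sizes`), `∫‖e‖² ≤ 3(…)/ρ²`. [folklore] -/
theorem cell_e1_L2 {e : E3 → E3} (hρ : 2 ≤ ρ) (ha : 0 ≤ a) (hK₁ : 0 ≤ K₁) (hK₂ : 0 ≤ K₂) (hAE : 0 ≤ A_E) (hC : 0 ≤ C)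
    (hw : ContDiff ℝ (⊤ : ℕ∞) w)
    (hgr : ∫ x in ball c (2 * ρ ^ 8), ‖w x‖ ^ 2 ≤ A_E * (2 * ρ ^ 8))
    (iDψ : Integrable fun x => ‖fderiv ℝ ψ x‖ ^ 2) (hDψ : ∫ x, ‖fderiv ℝ ψ x‖ ^ 2 ≤ C * A_E * ρ ^ 8)
    (he0 : ∀ x, x ∉ ball c (ρ ^ 8 + ρ ^ 7) \ ball c (ρ ^ 8) → e x = 0) (hie : Integrable fun x => ‖e x‖ ^ 2)
    (hle : ∀ x ∈ ball c (ρ ^ 8 + ρ ^ 7) \ ball c (ρ ^ 8), ‖e x‖ ≤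
      ‖curlCLM‖ * (K₁ / ρ ^ 7) * (a / ρ ^ 8) + ‖curlCLM‖ * ‖curlCLM‖ * (2 * K₂ / (ρ ^ 7) ^ 2) * (a * ρ) +
        ‖curlCLM‖ * (K₁ / ρ ^ 7) * ‖w x‖ + ‖curlCLM‖ * ‖curlCLM‖ * (K₁ / ρ ^ 7) * ‖fderiv ℝ ψ x‖) :
    ∫ x, ‖e x‖ ^ 2 ≤ 3 * (34 * (‖curlCLM‖ * K₁ * a + 2 * ‖curlCLM‖ * ‖curlCLM‖ * K₂ * a) ^ 2 +
      2 * ‖curlCLM‖ ^ 2 * K₁ ^ 2 * A_E + ‖curlCLM‖ ^ 4 * K₁ ^ 2 * C * A_E) / ρ ^ 2 := by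
  have hρ0 : 0 < ρ := by linarith
  have hρ78 : ρ ^ 8 + ρ ^ 7 ≤ 2 * ρ ^ 8 := by
    have : ρ ^ 7 ≤ ρ ^ 8 := by rw [show ρ ^ 8 = ρ * ρ ^ 7 by ring]; exact le_mul_of_one_le_left (by positivity) (by linarith)
    linarith
  have hLS : ball c (ρ ^ 8 + ρ ^ 7) \ ball c (ρ ^ 8) ⊆ ball c (2 * ρ ^ 8) := fun x hx => ball_subset_ball hρ78 hx.1
  obtain ⟨hSvol, hvol⟩ := volume_ball_two_rho_le c hρ0
  have hwc : Continuous w := hw.continuous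
  have hf : IntegrableOn (fun x => ‖w x‖ ^ 2) (ball c (2 * ρ ^ 8)) :=
    ((hwc.norm.pow 2).continuousOn.integrableOn_compact (isCompact_closedBall c (2 * ρ ^ 8))).mono_set ball_subset_closedBall
  have hg : IntegrableOn (fun x => ‖fderiv ℝ ψ x‖ ^ 2) (ball c (2 * ρ ^ 8)) := iDψ.integrableOn
  have hmain := integral_sq_le_of_affine_three (e := e) hLS measurableSet_ball hSvol he0 hie
    (α := ‖curlCLM‖ * (K₁ / ρ ^ 7) * (a / ρ ^ 8) + ‖curlCLM‖ * ‖curlCLM‖ * (2 * K₂ / (ρ ^ 7) ^ 2) * (a * ρ))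
    (β := ‖curlCLM‖ * (K₁ / ρ ^ 7)) (γ := ‖curlCLM‖ * ‖curlCLM‖ * (K₁ / ρ ^ 7))
    (f := fun x => ‖w x‖) (g := fun x => ‖fderiv ℝ ψ x‖) hf hg (fun x hx => by
      have := hle x hx; linarith only [this])
  have hgS : ∫ x in ball c (2 * ρ ^ 8), ‖fderiv ℝ ψ x‖ ^ 2 ≤ C * A_E * ρ ^ 8 :=
    (setIntegral_le_integral iDψ (ae_of_all _ fun x => sq_nonneg _)).trans hDψ
  obtain ⟨c1, c2, c3⟩ := cell_e1_consts (a := a) (cc := ‖curlCLM‖) (K₁ := K₁) (K₂ := K₂) (A_E := A_E) (C := C)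
    hρ ha (norm_nonneg curlCLM) hK₁ hK₂ hAE hC
  have hα0 : 0 ≤ (‖curlCLM‖ * (K₁ / ρ ^ 7) * (a / ρ ^ 8) + ‖curlCLM‖ * ‖curlCLM‖ * (2 * K₂ / (ρ ^ 7) ^ 2) * (a * ρ)) ^ 2 := sq_nonneg _
  have hβ0 : 0 ≤ (‖curlCLM‖ * (K₁ / ρ ^ 7)) ^ 2 := sq_nonneg _
  have hγ0 : 0 ≤ (‖curlCLM‖ * ‖curlCLM‖ * (K₁ / ρ ^ 7)) ^ 2 := sq_nonneg _
  have u1 := mul_le_mul_of_nonneg_left hvol hα0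
  have u2 := mul_le_mul_of_nonneg_left hgr hβ0
  have u3 := mul_le_mul_of_nonneg_left hgS hγ0
  have e : 3 * (34 * (‖curlCLM‖ * K₁ * a + 2 * ‖curlCLM‖ * ‖curlCLM‖ * K₂ * a) ^ 2 + 2 * ‖curlCLM‖ ^ 2 * K₁ ^ 2 * A_E +
      ‖curlCLM‖ ^ 4 * K₁ ^ 2 * C * A_E) / ρ ^ 2 = 3 * (34 * (‖curlCLM‖ * K₁ * a + 2 * ‖curlCLM‖ * ‖curlCLM‖ * K₂ * a) ^ 2 / ρ ^ 2 +
      2 * ‖curlCLM‖ ^ 2 * K₁ ^ 2 * A_E / ρ ^ 2 + ‖curlCLM‖ ^ 4 * K₁ ^ 2 * C * A_E / ρ ^ 2) := by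
    field_simp
  rw [e]
  linarith only [hmain, u1, u2, u3, c1, c2, c3]

set_option maxHeartbeats 400000 in
/-- **`L²` budget of the palinstrophy offset of a cell piece** (shape of `norm_fderiv_curl_piece_sub_le_of_sizes`). [folklore] -/
theorem cell_e2_L2 {e : E3 → E3} {K₃ : ℝ} (hρ : 2 ≤ ρ) (ha : 0 ≤ a) (hK₁ : 0 ≤ K₁) (hK₂ : 0 ≤ K₂) (hK₃ : 0 ≤ K₃) (hAE : 0 ≤ A_E)
    (hC : 0 ≤ C) (hw : ContDiff ℝ (⊤ : ℕ∞) w)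
    (hgr : ∫ x in ball c (2 * ρ ^ 8), ‖w x‖ ^ 2 ≤ A_E * (2 * ρ ^ 8))
    (iDψ : Integrable fun x => ‖fderiv ℝ ψ x‖ ^ 2) (hDψ : ∫ x, ‖fderiv ℝ ψ x‖ ^ 2 ≤ C * A_E * ρ ^ 8)
    (iD2ψ : Integrable fun x => ‖iteratedFDeriv ℝ 2 ψ x‖ ^ 2)
    (hD2ψ : ∫ x, ‖iteratedFDeriv ℝ 2 ψ x‖ ^ 2 ≤ C * (Zb w c (4 * ρ ^ 8) + A_E / ρ ^ 8))
    (he0 : ∀ x, x ∉ ball c (ρ ^ 8 + ρ ^ 7) \ ball c (ρ ^ 8) → e x = 0) (hie : Integrable fun x => ‖e x‖ ^ 2)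
    (hle : ∀ x ∈ ball c (ρ ^ 8 + ρ ^ 7) \ ball c (ρ ^ 8), ‖e x‖ ≤
      ‖curlCLM‖ * (2 * K₂ / (ρ ^ 7) ^ 2 * (a / ρ ^ 8) + K₁ / ρ ^ 7 * (a / ρ ^ 16)) + ‖curlCLM‖ * ‖curlCLM‖ * (6 * K₃ / (ρ ^ 7) ^ 3) * (a * ρ) +
        K₁ / ρ ^ 7 * ‖curl w x‖ + ‖curlCLM‖ * (2 * K₂ / (ρ ^ 7) ^ 2) * ‖w x‖ + ‖curlCLM‖ * (K₁ / ρ ^ 7) * ‖fderiv ℝ w x‖ +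
        2 * ‖curlCLM‖ * ‖curlCLM‖ * (2 * K₂ / (ρ ^ 7) ^ 2) * ‖fderiv ℝ ψ x‖ + ‖curlCLM‖ * ‖curlCLM‖ * (K₁ / ρ ^ 7) * ‖iteratedFDeriv ℝ 2 ψ x‖) :
    ∫ x, ‖e x‖ ^ 2 ≤ 6 * (34 * (2 * ‖curlCLM‖ * K₂ * a + ‖curlCLM‖ * K₁ * a + 6 * ‖curlCLM‖ * ‖curlCLM‖ * K₃ * a) ^ 2 +
      K₁ ^ 2 + 8 * ‖curlCLM‖ ^ 2 * K₂ ^ 2 * A_E + ‖curlCLM‖ ^ 2 * K₁ ^ 2 + 16 * ‖curlCLM‖ ^ 4 * K₂ ^ 2 * C * A_E +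
      ‖curlCLM‖ ^ 4 * K₁ ^ 2 * C * (1 + A_E)) *
      (Zb w c (2 * ρ ^ 8) + Zb w c (4 * ρ ^ 8) + (∫ x in ball c (2 * ρ ^ 8), ‖fderiv ℝ w x‖ ^ 2) + 1) / ρ ^ 2 := by
  have hρ0 : 0 < ρ := by linarith
  have hρ78 : ρ ^ 8 + ρ ^ 7 ≤ 2 * ρ ^ 8 := by
    have : ρ ^ 7 ≤ ρ ^ 8 := by rw [show ρ ^ 8 = ρ * ρ ^ 7 by ring]; exact le_mul_of_one_le_left (by positivity) (by linarith)
    linarith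
  have hLS : ball c (ρ ^ 8 + ρ ^ 7) \ ball c (ρ ^ 8) ⊆ ball c (2 * ρ ^ 8) := fun x hx => ball_subset_ball hρ78 hx.1
  obtain ⟨hSvol, hvol⟩ := volume_ball_two_rho_le c hρ0
  have hwc : Continuous w := hw.continuous
  have hw1c : ContDiff ℝ 1 w := hw.of_le (by norm_cast)
  have hf₁ : IntegrableOn (fun x => ‖curl w x‖ ^ 2) (ball c (2 * ρ ^ 8)) :=
    (((continuous_curl hw1c).norm.pow 2).continuousOn.integrableOn_compact (isCompact_closedBall c (2 * ρ ^ 8))).mono_set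
      ball_subset_closedBall
  have hf₂ : IntegrableOn (fun x => ‖w x‖ ^ 2) (ball c (2 * ρ ^ 8)) :=
    ((hwc.norm.pow 2).continuousOn.integrableOn_compact (isCompact_closedBall c (2 * ρ ^ 8))).mono_set ball_subset_closedBall
  have hf₃ : IntegrableOn (fun x => ‖fderiv ℝ w x‖ ^ 2) (ball c (2 * ρ ^ 8)) :=
    (((hw.continuous_fderiv (by simp)).norm.pow 2).continuousOn.integrableOn_compact (isCompact_closedBall c (2 * ρ ^ 8))).mono_set
      ball_subset_closedBall
  have hf₄ : IntegrableOn (fun x => ‖fderiv ℝ ψ x‖ ^ 2) (ball c (2 * ρ ^ 8)) := iDψ.integrableOn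
  have hf₅ : IntegrableOn (fun x => ‖iteratedFDeriv ℝ 2 ψ x‖ ^ 2) (ball c (2 * ρ ^ 8)) := iD2ψ.integrableOn
  have hmain := integral_sq_le_of_affine_six (e := e) hLS measurableSet_ball hSvol he0 hie
    (α := ‖curlCLM‖ * (2 * K₂ / (ρ ^ 7) ^ 2 * (a / ρ ^ 8) + K₁ / ρ ^ 7 * (a / ρ ^ 16)) + ‖curlCLM‖ * ‖curlCLM‖ * (6 * K₃ / (ρ ^ 7) ^ 3) * (a * ρ))
    (b₁ := K₁ / ρ ^ 7) (b₂ := ‖curlCLM‖ * (2 * K₂ / (ρ ^ 7) ^ 2)) (b₃ := ‖curlCLM‖ * (K₁ / ρ ^ 7))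
    (b₄ := 2 * ‖curlCLM‖ * ‖curlCLM‖ * (2 * K₂ / (ρ ^ 7) ^ 2)) (b₅ := ‖curlCLM‖ * ‖curlCLM‖ * (K₁ / ρ ^ 7))
    (f₁ := fun x => ‖curl w x‖) (f₂ := fun x => ‖w x‖) (f₃ := fun x => ‖fderiv ℝ w x‖) (f₄ := fun x => ‖fderiv ℝ ψ x‖)
    (f₅ := fun x => ‖iteratedFDeriv ℝ 2 ψ x‖) hf₁ hf₂ hf₃ hf₄ hf₅ (fun x hx => by
      have := hle x hx; linarith only [this])
  have hZ₂ : ∫ x in ball c (2 * ρ ^ 8), ‖curl w x‖ ^ 2 = Zb w c (2 * ρ ^ 8) := rfl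
  have hgS : ∫ x in ball c (2 * ρ ^ 8), ‖fderiv ℝ ψ x‖ ^ 2 ≤ C * A_E * ρ ^ 8 :=
    (setIntegral_le_integral iDψ (ae_of_all _ fun x => sq_nonneg _)).trans hDψ
  have hgS2 : ∫ x in ball c (2 * ρ ^ 8), ‖iteratedFDeriv ℝ 2 ψ x‖ ^ 2 ≤ C * (Zb w c (4 * ρ ^ 8) + A_E / ρ ^ 8) :=
    (setIntegral_le_integral iD2ψ (ae_of_all _ fun x => sq_nonneg _)).trans hD2ψ
  have hZ20 : 0 ≤ Zb w c (2 * ρ ^ 8) := Zb_nonneg w c _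
  have hZ40 : 0 ≤ Zb w c (4 * ρ ^ 8) := Zb_nonneg w c _
  have hD20 : 0 ≤ ∫ x in ball c (2 * ρ ^ 8), ‖fderiv ℝ w x‖ ^ 2 := setIntegral_nonneg measurableSet_ball fun x _ => sq_nonneg _
  obtain ⟨c1, c2, c3, c4, c5, c6⟩ := cell_e2_consts (a := a) (cc := ‖curlCLM‖) (K₁ := K₁) (K₂ := K₂) (K₃ := K₃) (A_E := A_E) (C := C)
    hρ ha (norm_nonneg curlCLM) hK₁ hK₂ hK₃ hAE hC hZ20 hD20 hZ40
  have u1 := mul_le_mul_of_nonneg_left hvol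
    (sq_nonneg (‖curlCLM‖ * (2 * K₂ / (ρ ^ 7) ^ 2 * (a / ρ ^ 8) + K₁ / ρ ^ 7 * (a / ρ ^ 16)) +
      ‖curlCLM‖ * ‖curlCLM‖ * (6 * K₃ / (ρ ^ 7) ^ 3) * (a * ρ)))
  have u3 := mul_le_mul_of_nonneg_left hgr (sq_nonneg (‖curlCLM‖ * (2 * K₂ / (ρ ^ 7) ^ 2)))
  have u4 := mul_le_mul_of_nonneg_left hgS (sq_nonneg (2 * ‖curlCLM‖ * ‖curlCLM‖ * (2 * K₂ / (ρ ^ 7) ^ 2)))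
  have u5 := mul_le_mul_of_nonneg_left hgS2 (sq_nonneg (‖curlCLM‖ * ‖curlCLM‖ * (K₁ / ρ ^ 7)))
  rw [hZ₂] at hmain
  -- collect: each of the six terms is `≤ (its constant)·(budget)/ρ²`
  have hρ2 : 0 < ρ ^ 2 := by positivity
  set S : ℝ := Zb w c (2 * ρ ^ 8) + Zb w c (4 * ρ ^ 8) + (∫ x in ball c (2 * ρ ^ 8), ‖fderiv ℝ w x‖ ^ 2) + 1 with hS
  have hS1 : 1 ≤ S := by rw [hS]; linarith
  have hS0 : 0 ≤ S := by linarith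
  have v1 : 34 * (2 * ‖curlCLM‖ * K₂ * a + ‖curlCLM‖ * K₁ * a + 6 * ‖curlCLM‖ * ‖curlCLM‖ * K₃ * a) ^ 2 / ρ ^ 2 ≤
      34 * (2 * ‖curlCLM‖ * K₂ * a + ‖curlCLM‖ * K₁ * a + 6 * ‖curlCLM‖ * ‖curlCLM‖ * K₃ * a) ^ 2 * S / ρ ^ 2 :=
    div_le_div_of_nonneg_right (le_mul_of_one_le_right (by positivity) hS1) hρ2.le
  have v2 : K₁ ^ 2 * Zb w c (2 * ρ ^ 8) / ρ ^ 2 ≤ K₁ ^ 2 * S / ρ ^ 2 :=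
    div_le_div_of_nonneg_right (mul_le_mul_of_nonneg_left (by rw [hS]; linarith) (sq_nonneg _)) hρ2.le
  have v3 : 8 * ‖curlCLM‖ ^ 2 * K₂ ^ 2 * A_E / ρ ^ 2 ≤ 8 * ‖curlCLM‖ ^ 2 * K₂ ^ 2 * A_E * S / ρ ^ 2 :=
    div_le_div_of_nonneg_right (le_mul_of_one_le_right (by positivity) hS1) hρ2.le
  have v4 : ‖curlCLM‖ ^ 2 * K₁ ^ 2 * (∫ x in ball c (2 * ρ ^ 8), ‖fderiv ℝ w x‖ ^ 2) / ρ ^ 2 ≤ ‖curlCLM‖ ^ 2 * K₁ ^ 2 * S / ρ ^ 2 :=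
    div_le_div_of_nonneg_right (mul_le_mul_of_nonneg_left (by rw [hS]; linarith) (by positivity)) hρ2.le
  have v5 : 16 * ‖curlCLM‖ ^ 4 * K₂ ^ 2 * C * A_E / ρ ^ 2 ≤ 16 * ‖curlCLM‖ ^ 4 * K₂ ^ 2 * C * A_E * S / ρ ^ 2 :=
    div_le_div_of_nonneg_right (le_mul_of_one_le_right (by positivity) hS1) hρ2.le
  have v6 : ‖curlCLM‖ ^ 4 * K₁ ^ 2 * C * (Zb w c (4 * ρ ^ 8) + A_E) / ρ ^ 2 ≤ ‖curlCLM‖ ^ 4 * K₁ ^ 2 * C * (1 + A_E) * S / ρ ^ 2 := by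
    refine div_le_div_of_nonneg_right ?_ hρ2.le
    have hZ4S : Zb w c (4 * ρ ^ 8) ≤ S := by rw [hS]; linarith
    have : Zb w c (4 * ρ ^ 8) + A_E ≤ (1 + A_E) * S := by nlinarith only [hZ4S, hS1, hAE, hZ40]
    calc ‖curlCLM‖ ^ 4 * K₁ ^ 2 * C * (Zb w c (4 * ρ ^ 8) + A_E) ≤ ‖curlCLM‖ ^ 4 * K₁ ^ 2 * C * ((1 + A_E) * S) :=
          mul_le_mul_of_nonneg_left this (by positivity)
      _ = _ := by ring
  have e : 6 * (34 * (2 * ‖curlCLM‖ * K₂ * a + ‖curlCLM‖ * K₁ * a + 6 * ‖curlCLM‖ * ‖curlCLM‖ * K₃ * a) ^ 2 +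
      K₁ ^ 2 + 8 * ‖curlCLM‖ ^ 2 * K₂ ^ 2 * A_E + ‖curlCLM‖ ^ 2 * K₁ ^ 2 + 16 * ‖curlCLM‖ ^ 4 * K₂ ^ 2 * C * A_E +
      ‖curlCLM‖ ^ 4 * K₁ ^ 2 * C * (1 + A_E)) * S / ρ ^ 2 =
      6 * (34 * (2 * ‖curlCLM‖ * K₂ * a + ‖curlCLM‖ * K₁ * a + 6 * ‖curlCLM‖ * ‖curlCLM‖ * K₃ * a) ^ 2 * S / ρ ^ 2 +
        K₁ ^ 2 * S / ρ ^ 2 + 8 * ‖curlCLM‖ ^ 2 * K₂ ^ 2 * A_E * S / ρ ^ 2 + ‖curlCLM‖ ^ 2 * K₁ ^ 2 * S / ρ ^ 2 +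
        16 * ‖curlCLM‖ ^ 4 * K₂ ^ 2 * C * A_E * S / ρ ^ 2 + ‖curlCLM‖ ^ 4 * K₁ ^ 2 * C * (1 + A_E) * S / ρ ^ 2) := by
    field_simp
  rw [e]
  linarith only [hmain, u1, u3, u4, u5, c1, c2, c3, c4, c5, c6, v1, v2, v3, v4, v5, v6]

end Cell

end Summit.NavierStokesRegularity.NavierStokesRegularity.Theorems.NearExtremalTransiencePerFlow.TwoThirds

end
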